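/-
Copyright (c) 2026 the pub-hodgecm-mathlib formalisation cell (harness21).  Prover seat hodgecm-mathlib-R90-C133-p02 (g0), Track B ∕ R90-TF, h413 = `stmt-HodgeConjecture-24833`,
R90-TF section S8 «ContSpec-n½» (T-hr2-3 of the `hr2` road, announced 2026-09-04T23:03Z): the QUOTIENT TRANSFER of the upper-tail Siegel law — a function on the automorphic quotient of
`U(2,1)_{L∕L⁺}` dominated by `𝟙[T < w₁]·w₁^a` with `a < 1` is square-integrable; in particular the Siegel-top tail of the middle residue (`a = ½`).
-/
import Summits.HodgeConjecture.HodgeConjecture.Theorems.K2E1ChiEisensteinMiddleResidueMemL2CMThree   -- ★ p862859 (this seat): the UPPER-TAIL Siegel law `lintegral_indicator_lt_borelHeight_rpow_mul_weight_lt_top_cm_three`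
import Summits.HodgeConjecture.HodgeConjecture.Theorems.K2E1BLEisensteinInWeightedSpaceU2Weights     -- ★ (K2E4-p23): `supHeight_eq_ciSup_arithmetic`; brings ★ `exists_ne_zero_lintegral_tsum_borelQuotient_eq_mul_lintegral_fin`, `exists_isCoveringWeight_arithmeticBorel`, `supHeight`
import Summits.HodgeConjecture.HodgeConjecture.Theorems.K2E1BLHeckeOperatorHXU2                    -- ★ `measurable_supHeight`; brings ★ `bddAbove_range_borelHeight_arith_mul`
import Summits.HodgeConjecture.HodgeConjecture.Theorems.K2E1BLHeightCosetsU3                        -- ★ `exists_forall_borelHeight_mul_le` (`w₁` is attained, `N = 3`)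
import HarnessLib

/-!
# K2·E1 ∕ R90·S8 — `K2E1SiegelTailMemL2CMThree` (T-hr2-3): THE SIEGEL TAIL `𝟙[T < w₁]·w₁^a` IS SQUARE-INTEGRABLE ON THE AUTOMORPHIC QUOTIENT OF `U(2,1)_{L∕L⁺}` FOR `a < 1`
# — the quotient transfer of ★ p862859's upper-tail Siegel law, by the every-rank Borel coset-sum unfolding

Track B ∕ R90-TF, crux h413 = `stmt-HodgeConjecture-24833`, route of record `HCCMUnconditional`; cell `hodgecm-mathlib`, R90-TF section S8 «ContSpec-n½ ∕ ResidualSpectrum», socket #3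
`sock_S8_res_piN_occurs`, letter (NV), sub-letter `hr2` — this file pays the `hTail` letter of ★ `memLp_quotFun_middleResidue_of_letters` for the Siegel-top tail
`x ↦ 𝟙[T < w₁ x]·ρψ(γ₀ỹ·ỹ)·H(γ₀ỹ·ỹ)^{2−z₀}` of ★ `K2E1ChiContinuedEisensteinMiddleResidueCMThree.quotFun_residue_ae_eq_add_tail` (K2E1-p16), whose modulus is `≤ ‖ρψ‖_∞·𝟙[T < w₁]·w₁^{Re(2−z₀)}`
(`H(γ₀ỹ·ỹ) = w₁(x)`), with `Re(2 − z₀) = ½ < 1` at the middle pole.  THEOREMS ONLY (no `def`, no `instance`, no notation, no named-fact hypothesis, no `sorry`; default heartbeats);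
lane `--supports stmt-HodgeConjecture-24833 --as helper` (count-neutral).  CLOSES NO SOCKET.

THE MATHEMATICS ([MoeglinWaldspurger1995, I.2.13, I.4.11]; [Gelbart1975, §9.B]; [Godement1964, §8]).  `X = G(𝔸)⧸G(F)`, `w₁(x) = max_γ H(γ·x̃⁻¹)` (★ `supHeight`, attained ★
`exists_forall_borelHeight_mul_le`).  For `ψ := 𝟙{T < H}·H^τ` (left-`B(F)`-invariant, ★ `UnitaryGroup.borelHeight_arithmeticBorel_mul`) the Borel coset sum `Σ_{q ∈ B(F)∖G(F)} ψ(q̃·x̃⁻¹)` dominates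
`𝟙[T < w₁(x)]·w₁(x)^τ` (the maximiser's coset alone gives it), and ★ UNFOLDING `∫⁻_X Σ_q ψ(q̃ x̃⁻¹) dμ = C·∫⁻_{G(𝔸)} β·ψ dν_G` (★ `exists_ne_zero_lintegral_tsum_borelQuotient_eq_mul_lintegral_fin`,
every covering weight `β` of `B(F)♯ = B(𝔸) ⊓ G(F)`, `C < ∞`) turns the right side into the `G(𝔸)` integral bounded by ★ p862859's UPPER-TAIL law (`τ < 2`).  Hence
`∫⁻_X 𝟙[T < w₁]·w₁^τ dμ < ∞` for every `τ < 2`, `T > 0` (§2), and a function with `‖f‖ ≤ K·𝟙[T < w₁]·w₁^a`, `a < 1`, is in `L²(μ)` (§3, `τ = 2a`).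
* §1 **`lintegral_ite_lt_supHeight_rpow_le_mul_lintegral_weight_three`** — the unfolding DOMINATION at `U(J₃)` (generic `F, E, c`): `∫⁻_X 𝟙[T<w₁]·w₁^τ dμ ≤ C·∫⁻ β·𝟙{T<H}·H^τ dν_G`.
* §2 **`lintegral_ite_lt_supHeight_rpow_lt_top_cm_three`** — `< ∞` for `τ < 2`, `T > 0` at the CM pair.
* §3 **`memLp_two_of_norm_le_ite_supHeight_rpow_cm_three`** — `MemLp f 2 μ` from `‖f x‖ ≤ K·𝟙[T < w₁ x]·(w₁ x)^a`, `a < 1`, `f` a.e.-strongly measurable.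
HONEST LABEL: HC_CM is proved only modulo the 7 printed citations (2 remaining named inputs: hLiu418 = `stmt-HodgeConjecture-24832`, h413 = `stmt-HodgeConjecture-24833`) until
rung 0 closes; REL ≠ ★ ≠ BUILT; this file is letter-free over ★ except for the Haar measure `ν_G` with `IsInvInvariant` it is handed (unimodularity, ★ K2E3 elsewhere); it asserts no
named fact and closes no socket; count-neutral.

## References
* [MoeglinWaldspurger1995] C. Mœglin, J.-L. Waldspurger, *Spectral Decomposition and Eisenstein Series* (1995), I.2.13, I.4.11.
* [Gelbart1975] S. Gelbart, *Automorphic forms on adele groups* (1975), §9.B (9.40)–(9.46).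
* [Godement1964] R. Godement, *Domaines fondamentaux des groupes arithmétiques*, Sém. Bourbaki 257 (1964), §8.
-/

set_option autoImplicit false
set_option linter.dupNamespace false  -- the mandated namespace repeats the single-problem summit's segment

noncomputable section

open MeasureTheory MeasureTheory.Measure Set Filter Topology NumberField
open scoped ENNReal NNReal
open Literature.MeasureTheory.Group
open Literature.NumberTheory.Automorphic Literature.NumberTheory.Automorphic.UnitaryGroup AdelicGroupData
open Summit.HodgeConjecture.HodgeConjecture.Cruxes.H413.K2E1BLBorelSpacesU2Defs
open Summit.HodgeConjecture.HodgeConjecture.Cruxes.H413.K2E1BLEisensteinInWeightedSpaceU2 (exists_ne_zero_lintegral_tsum_borelQuotient_eq_mul_lintegral_fin exists_isCoveringWeight_arithmeticBorel)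
open Summit.HodgeConjecture.HodgeConjecture.Cruxes.H413.K2E1BLEisensteinInWeightedSpaceU2Weights (supHeight_eq_ciSup_arithmetic)
open Summit.HodgeConjecture.HodgeConjecture.Cruxes.H413.K2E1BLHeckeOperatorWeightedU2 (bddAbove_range_borelHeight_arith_mul)
open Summit.HodgeConjecture.HodgeConjecture.Cruxes.H413.K2E1BLHeckeOperatorHXU2 (measurable_supHeight)
open Summit.HodgeConjecture.HodgeConjecture.Cruxes.H413.K2E1BLHeightCosetsU3 (exists_forall_borelHeight_mul_le)
open Summit.HodgeConjecture.HodgeConjecture.Cruxes.H413.K2E1ChiEisensteinMiddleResidueMemL2CMThree (lintegral_indicator_lt_borelHeight_rpow_mul_weight_lt_top_cm_three)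

namespace Summit.HodgeConjecture.HodgeConjecture.Cruxes.H413.K2E1SiegelTailMemL2CMThree

/-! ## §1 The unfolding domination at `U(J₃)` (generic CM-type pair `E ∕ F`) -/

section Unfold

variable {F E : Type} [Field F] [NumberField F] [Field E] [NumberField E] [Algebra F E] {c : E ≃ₐ[F] E}
  [MeasurableSpace (quasiSplit F E c 3).Adelic] [BorelSpace (quasiSplit F E c 3).Adelic]

/-- **`∫⁻_X 𝟙[T < w₁]·w₁^τ dμ ≤ C·∫⁻_{G(𝔸)} β·𝟙{T < H}·H^τ dν_G`** for every covering weight `β` of `B(F)♯`, with ONE constant `C < ∞` (Weil's unfolding constant): the Borel coset sum of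
`ψ = 𝟙{T < H}·H^τ` dominates the tail at the maximiser (★ `exists_forall_borelHeight_mul_le`, ★ `supHeight_eq_ciSup_arithmetic`), and ★ `exists_ne_zero_lintegral_tsum_borelQuotient_eq_mul_lintegral_fin`
unfolds it. [cite: Gelbart1975, §9.B (9.44)–(9.46)] [cite: MoeglinWaldspurger1995, I.2.13] -/
theorem lintegral_ite_lt_supHeight_rpow_le_mul_lintegral_weight_three
    (μ : Measure (quasiSplit F E c 3).automorphicQuotient) [(quasiSplit F E c 3).IsAutomorphicMeasure μ]
    (νG : Measure (quasiSplit F E c 3).Adelic) [νG.IsHaarMeasure] [νG.IsInvInvariant] :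
    ∃ C : ℝ≥0∞, C ≠ ⊤ ∧ ∀ (β : (quasiSplit F E c 3).Adelic → ℝ≥0∞),
      IsCoveringWeight ((arithmeticBorel F E c 3).map (quasiSplit F E c 3).arithmeticSubgroup.subtype) β →
      ∀ (T : ℝ≥0) (τ : ℝ),
        ∫⁻ x, (if T < supHeight F E c 3 x then ENNReal.ofReal ((supHeight F E c 3 x : ℝ) ^ τ) else 0) ∂μ ≤
          C * ∫⁻ g, β g * {g | T < borelHeight g}.indicator (fun g => ENNReal.ofReal ((borelHeight g : ℝ) ^ τ)) g ∂νG := by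
  obtain ⟨C, -, hCt, hunf⟩ := exists_ne_zero_lintegral_tsum_borelQuotient_eq_mul_lintegral_fin (F := F) (E := E) (c := c) (N := 3) μ νG
  refine ⟨C, hCt, fun β hβ T τ => ?_⟩
  set ψ : (quasiSplit F E c 3).Adelic → ℝ≥0∞ := {g | T < borelHeight g}.indicator (fun g => ENNReal.ofReal ((borelHeight g : ℝ) ^ τ)) with hψ
  have hψm : Measurable ψ :=
    (continuous_borelHeight.measurable.coe_nnreal_real.pow_const _).ennreal_ofReal.indicator (measurableSet_lt measurable_const continuous_borelHeight.measurable)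
  have hψinv : ∀ b ∈ arithmeticBorel F E c 3, ∀ y : (quasiSplit F E c 3).Adelic, ψ (((b : (quasiSplit F E c 3).arithmeticSubgroup) : (quasiSplit F E c 3).Adelic) * y) = ψ y := by
    intro b hb y
    simp only [hψ, Set.indicator_apply, Set.mem_setOf_eq, UnitaryGroup.borelHeight_arithmeticBorel_mul hb y]
  rw [← hunf β hβ ψ hψm hψinv]
  refine lintegral_mono fun x => ?_
  -- the maximiser of `γ ↦ H(γ·x̃⁻¹)`
  set y : (quasiSplit F E c 3).Adelic := (Quotient.out (x : (quasiSplit F E c 3).Adelic ⧸ (quasiSplit F E c 3).quotientSubgroup))⁻¹ with hy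
  obtain ⟨γ₀, hγ₀⟩ := exists_forall_borelHeight_mul_le (F := F) (E := E) (c := c) y
  have hW : supHeight F E c 3 x = borelHeight ((γ₀ : (quasiSplit F E c 3).Adelic) * y) := by
    rw [supHeight_eq_ciSup_arithmetic, ← hy]
    exact le_antisymm (ciSup_le hγ₀) (le_ciSup (bddAbove_range_borelHeight_arith_mul y) γ₀)
  -- the coset of `γ₀` and its representative `q₀.out = b'·γ₀`, `b' ∈ B(F)`
  set q₀ : Quotient (QuotientGroup.rightRel (arithmeticBorel F E c 3)) := Quotient.mk (QuotientGroup.rightRel (arithmeticBorel F E c 3)) γ₀ with hq₀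
  have hrel : γ₀ * (q₀.out)⁻¹ ∈ arithmeticBorel F E c 3 := by
    have h := Quotient.mk_out (s := QuotientGroup.rightRel (arithmeticBorel F E c 3)) γ₀
    exact QuotientGroup.rightRel_apply.1 h
  have hb' : q₀.out * γ₀⁻¹ ∈ arithmeticBorel F E c 3 := by
    have h := inv_mem hrel
    rwa [mul_inv_rev, inv_inv] at h
  have hout : ((q₀.out : (quasiSplit F E c 3).arithmeticSubgroup) : (quasiSplit F E c 3).Adelic) * y =
      (((q₀.out * γ₀⁻¹ : (quasiSplit F E c 3).arithmeticSubgroup)) : (quasiSplit F E c 3).Adelic) * (((γ₀ : (quasiSplit F E c 3).Adelic)) * y) := by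
    rw [← mul_assoc, ← Subgroup.coe_mul, inv_mul_cancel_right]
  have hterm : ψ (((q₀.out : (quasiSplit F E c 3).arithmeticSubgroup) : (quasiSplit F E c 3).Adelic) * y) =
      (if T < supHeight F E c 3 x then ENNReal.ofReal ((supHeight F E c 3 x : ℝ) ^ τ) else 0) := by
    rw [hout, hψinv _ hb', hW, hψ]
    by_cases hlt : T < borelHeight ((γ₀ : (quasiSplit F E c 3).Adelic) * y)
    · rw [Set.indicator_of_mem (show (γ₀ : (quasiSplit F E c 3).Adelic) * y ∈ {g | T < borelHeight g} from hlt), if_pos hlt]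
    · rw [Set.indicator_of_notMem (show (γ₀ : (quasiSplit F E c 3).Adelic) * y ∉ {g | T < borelHeight g} from hlt), if_neg hlt]
  calc (if T < supHeight F E c 3 x then ENNReal.ofReal ((supHeight F E c 3 x : ℝ) ^ τ) else 0)
        = ψ (((q₀.out : (quasiSplit F E c 3).arithmeticSubgroup) : (quasiSplit F E c 3).Adelic) * y) := hterm.symm
    _ ≤ ∑' q : Quotient (QuotientGroup.rightRel (arithmeticBorel F E c 3)),
          ψ (((q.out : (quasiSplit F E c 3).arithmeticSubgroup) : (quasiSplit F E c 3).Adelic) * y) := ENNReal.le_tsum q₀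

end Unfold

/-! ## §2 `< ∞` at the CM pair for `τ < 2` -/

section CM

variable (L : Type) [Field L] [NumberField L] [IsCMField L]
  [MeasurableSpace (quasiSplit (↥(maximalRealSubfield L)) L (IsCMField.complexConj L) 3).Adelic] [BorelSpace (quasiSplit (↥(maximalRealSubfield L)) L (IsCMField.complexConj L) 3).Adelic]

/-- **THE SIEGEL TAIL LAW ON THE QUOTIENT**: `∫⁻_X 𝟙[T < w₁]·w₁^τ dμ < ∞` for every `τ < 2`, `T > 0`, automorphic `μ` on `X = U(J₃)(𝔸_{L⁺})⧸U(J₃)(L⁺)` — §1 with ANY covering weight of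
`B(L⁺)♯` (one exists, ★ `exists_isCoveringWeight_arithmeticBorel`; `B(L⁺)♯ = B(𝔸) ⊓ G(L⁺)` by `Subgroup.subgroupOf_map_subtype`) and ★ p862859's upper-tail law on `G(𝔸)`.  Requires an
inversion-invariant Haar measure `ν_G` on `G(𝔸)` (unimodularity; handed in). [cite: MoeglinWaldspurger1995, I.2.13, I.4.11] [cite: Godement1964, §8] -/
theorem lintegral_ite_lt_supHeight_rpow_lt_top_cm_three
    (μ : Measure (quasiSplit (↥(maximalRealSubfield L)) L (IsCMField.complexConj L) 3).automorphicQuotient)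
    [(quasiSplit (↥(maximalRealSubfield L)) L (IsCMField.complexConj L) 3).IsAutomorphicMeasure μ]
    (νG : Measure (quasiSplit (↥(maximalRealSubfield L)) L (IsCMField.complexConj L) 3).Adelic) [νG.IsHaarMeasure] [νG.IsInvInvariant]
    {τ : ℝ} (hτ : τ < 2) {T : ℝ≥0} (hT : 0 < T) :
    ∫⁻ x, (if T < supHeight (↥(maximalRealSubfield L)) L (IsCMField.complexConj L) 3 x then
        ENNReal.ofReal ((supHeight (↥(maximalRealSubfield L)) L (IsCMField.complexConj L) 3 x : ℝ) ^ τ) else 0) ∂μ < ∞ := by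
  obtain ⟨C, hCt, hdom⟩ := lintegral_ite_lt_supHeight_rpow_le_mul_lintegral_weight_three μ νG
  obtain ⟨β, hβ⟩ := exists_isCoveringWeight_arithmeticBorel (F := ↥(maximalRealSubfield L)) (E := L) (c := IsCMField.complexConj L) (N := 3)
  have hβ' : IsCoveringWeight ↥(borelAdelic (↥(maximalRealSubfield L)) L (IsCMField.complexConj L) 3 ⊓
      (quasiSplit (↥(maximalRealSubfield L)) L (IsCMField.complexConj L) 3).arithmeticSubgroup) β := by
    have h : (arithmeticBorel (↥(maximalRealSubfield L)) L (IsCMField.complexConj L) 3).map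
        (quasiSplit (↥(maximalRealSubfield L)) L (IsCMField.complexConj L) 3).arithmeticSubgroup.subtype =
        borelAdelic (↥(maximalRealSubfield L)) L (IsCMField.complexConj L) 3 ⊓ (quasiSplit (↥(maximalRealSubfield L)) L (IsCMField.complexConj L) 3).arithmeticSubgroup :=
      Subgroup.subgroupOf_map_subtype _ _
    rw [← h]
    exact hβ
  refine lt_of_le_of_lt (hdom β hβ T τ) (ENNReal.mul_lt_top hCt.lt_top ?_)
  have hfin := lintegral_indicator_lt_borelHeight_rpow_mul_weight_lt_top_cm_three L νG hβ' hτ hT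
  calc ∫⁻ g, β g * {g | T < borelHeight g}.indicator (fun g => ENNReal.ofReal ((borelHeight g : ℝ) ^ τ)) g ∂νG
        = ∫⁻ g, {g | T < borelHeight g}.indicator (fun g => ENNReal.ofReal ((borelHeight g : ℝ) ^ τ)) g * β g ∂νG := by
          simp only [mul_comm]
    _ < ∞ := hfin

/-! ## §3 `L²` from domination by the Siegel tail -/

/-- **A FUNCTION DOMINATED BY THE SIEGEL TAIL `K·𝟙[T < w₁]·w₁^a`, `a < 1`, IS IN `L²(μ)`** (the exponent criterion [MW95 I.4.11] on the quotient: `τ = 2a < 2` in §2).  With K2E1-p16's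
tail `𝟙[T < w₁ x]·ρψ(γ₀ỹ·ỹ)·H(γ₀ỹ·ỹ)^{2−z₀}` (`H(γ₀ỹ·ỹ) = w₁ x`, `‖H^{2−z₀}‖ = H^{Re(2−z₀)}`) and a bound `‖ρψ‖ ≤ K` this is the `hTail` letter of ★ `memLp_quotFun_middleResidue_of_letters`
at the middle pole (`a = ½`). [cite: MoeglinWaldspurger1995, I.4.11] [cite: Godement1964, §8] -/
theorem memLp_two_of_norm_le_ite_supHeight_rpow_cm_three
    (μ : Measure (quasiSplit (↥(maximalRealSubfield L)) L (IsCMField.complexConj L) 3).automorphicQuotient)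
    [(quasiSplit (↥(maximalRealSubfield L)) L (IsCMField.complexConj L) 3).IsAutomorphicMeasure μ]
    (νG : Measure (quasiSplit (↥(maximalRealSubfield L)) L (IsCMField.complexConj L) 3).Adelic) [νG.IsHaarMeasure] [νG.IsInvInvariant]
    {a : ℝ} (ha : a < 1) {T : ℝ≥0} (hT : 0 < T) {K : ℝ}
    {f : (quasiSplit (↥(maximalRealSubfield L)) L (IsCMField.complexConj L) 3).automorphicQuotient → ℂ} (hf : AEStronglyMeasurable f μ)
    (hbound : ∀ x, ‖f x‖ ≤ K * (if T < supHeight (↥(maximalRealSubfield L)) L (IsCMField.complexConj L) 3 x then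
        (supHeight (↥(maximalRealSubfield L)) L (IsCMField.complexConj L) 3 x : ℝ) ^ a else 0)) :
    MemLp f 2 μ := by
  -- the real majorant `g = K·𝟙[T<w₁]·w₁^a`
  set w : (quasiSplit (↥(maximalRealSubfield L)) L (IsCMField.complexConj L) 3).automorphicQuotient → ℝ≥0 :=
    supHeight (↥(maximalRealSubfield L)) L (IsCMField.complexConj L) 3 with hwdef
  have hwm : Measurable w := measurable_supHeight
  set g : (quasiSplit (↥(maximalRealSubfield L)) L (IsCMField.complexConj L) 3).automorphicQuotient → ℝ :=
    fun x => K * (if T < w x then (w x : ℝ) ^ a else 0) with hgdef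
  have hset : MeasurableSet {x | T < w x} := measurableSet_lt measurable_const hwm
  have hgm : Measurable g := measurable_const.mul (Measurable.ite hset (hwm.coe_nnreal_real.pow_const _) measurable_const)
  -- `g² = K²·𝟙[T<w₁]·w₁^{2a}` pointwise
  have hsq : ∀ x, g x ^ 2 = K ^ 2 * (if T < w x then (w x : ℝ) ^ (2 * a) else 0) := by
    intro x
    simp only [hgdef]
    split_ifs with h
    · rw [mul_pow, ← Real.rpow_natCast ((w x : ℝ) ^ a) 2, ← Real.rpow_mul (by positivity)]
      push_cast
      ring_nf
    · simp
  -- integrability of `g²` from §2 at `τ = 2a`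
  have hτ : 2 * a < 2 := by linarith
  have hfin := lintegral_ite_lt_supHeight_rpow_lt_top_cm_three L μ νG hτ hT
  have hhm : Measurable fun x => (if T < w x then (w x : ℝ) ^ (2 * a) else 0) := Measurable.ite hset (hwm.coe_nnreal_real.pow_const _) measurable_const
  have hh_int : Integrable (fun x => (if T < w x then (w x : ℝ) ^ (2 * a) else 0)) μ := by
    refine ⟨hhm.aestronglyMeasurable, ?_⟩
    rw [hasFiniteIntegral_iff_enorm]
    refine lt_of_le_of_lt (lintegral_mono fun x => ?_) hfin
    split_ifs with h
    · rw [Real.enorm_eq_ofReal (Real.rpow_nonneg (by positivity) _)]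
    · simp
  have hg2 : MemLp g 2 μ := by
    rw [memLp_two_iff_integrable_sq hgm.aestronglyMeasurable]
    have : (fun x => g x ^ 2) = fun x => K ^ 2 * (if T < w x then (w x : ℝ) ^ (2 * a) else 0) := funext hsq
    rw [this]
    exact hh_int.const_mul _
  refine hg2.of_le hf (ae_of_all _ fun x => ?_)
  rw [Real.norm_eq_abs]
  exact (hbound x).trans (le_abs_self _)

end CM

end Summit.HodgeConjecture.HodgeConjecture.Cruxes.H413.K2E1SiegelTailMemL2CMThree

end
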